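import Literature.Computability.QuantumComplexity.CubicForrelation

/-!
# `CubicForrelationInPrBPP` — negative knowledge: the crux's promise problem is non-degenerate (no junk refutation)

Support file for crux `stmt-QuantumAdvantage-2204`
(`Summit.QuantumAdvantage.QuantumAdvantage.Theses.CubicForrelation.CubicForrelationInPrBPP` =
`cubicKForrelationProblem 2 ∈ PromiseBPP'`), written by the standing disprover
refuter-cdisprove-stmt-QuantumAdvantage-2204-g2-0 (2026-08-15). A refuter's first attack on a membership claim
`Q ∈ PromiseBPP'` is junk: an overlapping promise (`yes ∩ no ≠ ∅` makes membership impossible since `2/3 + 2/3 > 1`)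
or an empty side (membership trivial). For `CF₂ = cubicKForrelationProblem 2` the tree already has a YES instance
(`encode_andPairInstance_mem_cubicKForrelationProblem_yes`: `f = g = x₀x₁`, `Φ = 1`) and disjointness
(`cubicKForrelationProblem_disjoint`); this file supplies the missing explicit NO instance and packages the three:

* `orTwoCircuit` (one `B₂` gate, `x₀ ∨ x₁`), `orAndInstance = (2, 2, x₀∨x₁, x₀∧x₁)` with `orAndInstance_value : Φ = 0`
  (`W_{x₀x₁} = (2,2,2,-2)` is orthogonal to `(-1)^{x₀∨x₁} = (1,-1,-1,-1)`), `orAndInstance_isNo`,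
  `encode_orAndInstance_mem_cubicKForrelationProblem_no`;
* `cubicForrelation_promise_nondegenerate`: both sides inhabited and disjoint.

## References

* [AaronsonAmbainis2018] S. Aaronson, A. Ambainis, Forrelation, SIAM J. Comput. 47 (2018), §1.1.1, §1.1.3, §6.
* [Carlet2020] C. Carlet, Boolean Functions for Cryptography and Coding Theory, CUP 2020, §2.2.1 Def. 6.
-/

noncomputable section

namespace Summit.QuantumAdvantage.QuantumAdvantage.Theorems.CubicForrelationInPrBPP.Negative

open Finset
open Literature.Computability.QuantumComplexity Literature.Computability.Complexity

/-! ### An explicit NO-instance of `cubicKForrelationProblem 2` -/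

/-- The one-gate `B₂`-circuit computing `x₀ ∨ x₁` on two inputs. [folklore] -/
def orTwoCircuit : Circuit (Fin 2) where
  gates := [⟨2, fun v => v 0 || v 1, fun a => .inl a⟩]
  output := .inr 0
  wf j h a m hm := by
    simp only [List.length_singleton, Nat.lt_one_iff] at h
    subst h
    simp at hm
  wf_output m h := by cases h; simp

/-- `orTwoCircuit` computes `x ↦ x₀ ∨ x₁`. [folklore] -/
@[simp] theorem orTwoCircuit_eval (x : Fin 2 → Bool) : orTwoCircuit.eval x = (x 0 || x 1) := rfl

/-- `orTwoCircuit` is over `B₂`. [folklore] -/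
theorem orTwoCircuit_isOver : orTwoCircuit.IsOver B2 := by
  intro g hg
  simp only [orTwoCircuit, List.mem_singleton] at hg
  subst hg
  exact le_refl 2

/-- `x₀ ∨ x₁ = [x₀ + x₁ + x₀x₁ = 1]` has algebraic degree `≤ 3`. [folklore] -/
theorem isDegLeFun_orTwoCircuit_eval : IsDegLeFun 3 orTwoCircuit.eval := by
  refine ⟨MvPolynomial.X 0 + MvPolynomial.X 1 + MvPolynomial.X 0 * MvPolynomial.X 1, ?_, fun x => ?_⟩
  · have hX : ∀ j : Fin 2, (MvPolynomial.X j : MvPolynomial (Fin 2) (ZMod 2)).totalDegree ≤ 1 :=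
      fun j => (MvPolynomial.totalDegree_X (R := ZMod 2) j).le
    have hXX : (MvPolynomial.X 0 * MvPolynomial.X 1 : MvPolynomial (Fin 2) (ZMod 2)).totalDegree ≤ 2 :=
      (MvPolynomial.totalDegree_mul _ _).trans (add_le_add (hX 0) (hX 1))
    refine (MvPolynomial.totalDegree_add _ _).trans (max_le ?_ (hXX.trans (by norm_num)))
    exact (MvPolynomial.totalDegree_add _ _).trans (max_le ((hX 0).trans (by norm_num))
      ((hX 1).trans (by norm_num)))
  · rw [orTwoCircuit_eval]
    simp only [polyPhase, map_add, map_mul, MvPolynomial.eval_X]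
    cases x 0 <;> cases x 1 <;> decide

/-- The two-bit instance `(n, k, C₀, C₁) = (2, 2, x₀ ∨ x₁, x₀ ∧ x₁)`. [folklore] -/
def orAndInstance : KForrelationInstance := ⟨2, 2, ![orTwoCircuit, andTwoCircuit]⟩

/-- `Φ_{x₀∨x₁, x₀∧x₁} = 0`: `W_{x₀x₁} = (2,2,2,-2)` is orthogonal to `(-1)^{x₀∨x₁} = (1,-1,-1,-1)`. [folklore] -/
theorem orAndInstance_value : orAndInstance.value = 0 := by
  show kForrelationValue (n := 2) (k := 2) (fun i => (![orTwoCircuit, andTwoCircuit] i).eval) = 0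
  rw [kForrelationValue_fin_two]
  simp only [Matrix.cons_val_zero, Matrix.cons_val_one]
  unfold forrelation
  simp only [orTwoCircuit_eval, andTwoCircuit_eval,
    ← (piFinTwoEquiv fun _ : Fin 2 => Bool).symm.sum_comp, Fintype.sum_prod_type, Fintype.sum_bool,
    twist, Fin.prod_univ_two, signOf]
  simp [piFinTwoEquiv]

/-- `orAndInstance` is a NO-instance (`B₂`-circuits, `|Φ| = 0 ≤ 1/100`). [folklore] -/
theorem orAndInstance_isNo : orAndInstance.IsNo := by
  refine ⟨fun i => ?_, by rw [orAndInstance_value]; norm_num⟩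
  fin_cases i
  · exact orTwoCircuit_isOver
  · exact andTwoCircuit_isOver

/-- **Non-vacuity of the no-side**: the code of `orAndInstance` is a no-instance of `CF₂`
(`k = 2`, `n = 2` even, both functions of degree `≤ 2 ≤ 3`). Together with the tree's
`encode_andPairInstance_mem_cubicKForrelationProblem_yes` and `cubicKForrelationProblem_disjoint 2`,
the crux's promise problem is a genuine one: membership in `PromiseBPP'` is neither trivially
impossible (overlap) nor trivially true (an empty side). [folklore] -/
theorem encode_orAndInstance_mem_cubicKForrelationProblem_no :
    orAndInstance.encode ∈ (cubicKForrelationProblem 2).no := by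
  refine ⟨orAndInstance, ⟨orAndInstance_isNo, rfl, ⟨1, rfl⟩, fun i => ?_⟩, rfl⟩
  fin_cases i
  · exact isDegLeFun_orTwoCircuit_eval
  · exact isDegLeFun_andTwoCircuit_eval

/-- Both sides of the crux's promise are inhabited and they are disjoint. [folklore] -/
theorem cubicForrelation_promise_nondegenerate :
    (cubicKForrelationProblem 2).yes.Nonempty ∧ (cubicKForrelationProblem 2).no.Nonempty ∧
      (cubicKForrelationProblem 2).Disjoint :=
  ⟨⟨_, encode_andPairInstance_mem_cubicKForrelationProblem_yes⟩,
    ⟨_, encode_orAndInstance_mem_cubicKForrelationProblem_no⟩, cubicKForrelationProblem_disjoint 2⟩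


end Summit.QuantumAdvantage.QuantumAdvantage.Theorems.CubicForrelationInPrBPP.Negative

end
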